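import Literature.LinearAlgebra.Matrix.AndoHiaiInequality
import Literature.LinearAlgebra.Matrix.GoldenThompsonLogMajorization
import HarnessLib

/-!
# The Ando–Hiai log-majorization `λ(Aʳ #_α Bʳ) ≺_(log) λ(A #_α B)ʳ` (`r ≥ 1`): the compound of a weighted geometric
# mean `C_k(A #_α B) = C_k(A) #_α C_k(B)`, `‖Aʳ #_α Bʳ‖ ≤ ‖A #_α B‖ʳ`, the prefix products
# `Π_{j<k} λ_j(Aʳ #_α Bʳ) ≤ Π_{j<k} λ_j(A #_α B)ʳ`, `|det(A #_α B)| = (det A)^{1−α}(det B)^α`, the monotone family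
# `λ((Aᵖ #_α Bᵖ)^{1/p}) ≺_(log) λ((A^q #_α B^q)^{1/q})` (`0 < q ≤ p`) and unitarily invariant norms
# (Ando–Hiai 1994, Lemma 1.2 and Theorem 2.1)

Hodge foundations lane (`lit-hodgefound`, prover p24 gen 63; matrix-analysis series, sequel of `AndoHiaiInequality.lean`
(`A #_t B ≤ cI ⟹ Aʳ #_t Bʳ ≤ cʳI`), the compound-matrix files (`SylvesterFranke` / `CompoundMatrixRank` /
`EigenvalueSingularValueMajorization`: `compound_mul`, `compound_inv`, `posDef_compound`,
`singularValues_compound_zero`), `ArakiLiebThirringLogMajorization.lean` (`compound_rpow`, `singularValues_zero_eq_norm`)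
and `GoldenThompsonLogMajorization.lean` (log-majorization ⟹ unitarily invariant norms)).  THEOREMS ONLY: no
definition, no named fact, net debt 0.  Complex matrices, `[LinearOrder n]` (the compound's index
`Set.powersetCard n k`), the spectral norm (`Matrix.Norms.L2Operator`).  As in the tree, `A #_t B` is SPELLED OUT as
`CFC.sqrt A * ((CFC.sqrt A)⁻¹ * B * (CFC.sqrt A)⁻¹) ^ t * CFC.sqrt A`; «`λ_j`» of the positive definite matrices
involved are Mathlib's singular values `(Matrix.toEuclideanLin X).singularValues j` (decreasing; `= λ_j(X)` for
`X ⪰ 0`, and `σ₀ = ‖·‖`).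

## Source, VERBATIM — T. Ando, F. Hiai, *Log majorization and complementary Golden–Thompson type inequalities*,
Linear Algebra Appl. 197/198 (1994) 113–131 [AndoHiai1994] (held text `paper:doi-10-1016-0024-3795-94-90484-7`,
§§ 1–2 pp. 115–120)

«For `A, B ≥ 0` let us write `A ≺_(log) B` (log majorization) if `Π_{i=1}^k λ_i(A) ≤ Π_{i=1}^k λ_i(B)`, `k = 1, …, n−1`,
and `Π_{i=1}^n λ_i(A) = Π_{i=1}^n λ_i(B)`, i.e. `det A = det B` … `A ≺_(log) B` implies `A ≺_w B` [weak majorization],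
so that `‖A‖ ≤ ‖B‖` for any unitarily invariant norm. **Lemma 1.2.** `C_k(A #_α B) = C_k(A) #_α C_k(B)`. **Lemma 1.3.**
`λ₁(C_k(A)) = Π_{i=1}^k λ_i(A)`. **Theorem 2.1.** For every `A, B ≥ 0` and `0 ≤ α ≤ 1`, `(Aʳ #_α Bʳ) ≺_(log) (A #_α B)ʳ`,
`r ≥ 1` (2.2), or equivalently `(Aᵖ #_α Bᵖ)^{1/p} ≺_(log) (A^q #_α B^q)^{1/q}`, `0 < q ≤ p` (2.3) … *Proof.* … It is
easy to see by Lemma 1.2 that for `k = 1, …, n`, `C_k(Aʳ #_α Bʳ) = C_k(A)ʳ #_α C_k(B)ʳ`, `C_k((A #_α B)ʳ) =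
(C_k(A) #_α C_k(B))ʳ`. Also `det(Aʳ #_α Bʳ) = (det A)^{r(1−α)}(det B)^{rα} = det(A #_α B)ʳ`. Hence it suffices by
Lemma 1.3 to show that `λ₁(Aʳ #_α Bʳ) ≤ λ₁(A #_α B)ʳ` (2.5).»

## What is formalized (all PROVED; `A, B ≻ 0`, `t ∈ [0, 1]`, `r ≥ 1`)

* § 1 **Lemma 1.2** `C_k(A #_t B) = C_k(A) #_t C_k(B)` (`compound_wgm`, Binet–Cauchy `C_k(XY) = C_k(X)C_k(Y)`,
  `C_k(X⁻¹) = C_k(X)⁻¹`, `C_k(Xˢ) = C_k(X)ˢ`, `C_k(X^{1/2}) = C_k(X)^{1/2}` (`compound_sqrt`)), «`C_k(Aʳ #_α Bʳ) =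
  C_k(A)ʳ #_α C_k(B)ʳ`» (`compound_wgm_rpow`) and the determinant clause in absolute value
  `|det(A #_t B)| = |det A|^{1−t}|det B|^t` (`norm_det_wgm`), `|det(Aʳ #_t Bʳ)| = |det(A #_t B)|ʳ` (`norm_det_wgm_rpow`).
* § 2 **(2.5) in norm form: `‖Aʳ #_t Bʳ‖ ≤ ‖A #_t B‖ʳ`** (`norm_wgm_rpow_le`, from the tree's `andoHiai_smul` with
  `c = ‖A #_t B‖`), i.e. `λ₁(Aʳ #_t Bʳ) ≤ λ₁(A #_t B)ʳ` (`singularValues_zero_wgm_rpow_le`).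
* § 3 **Theorem 2.1 (2.2)**: `Π_{j<k} λ_j(Aʳ #_t Bʳ) ≤ Π_{j<k} λ_j(A #_t B)ʳ` for every `k`
  (`prod_singularValues_wgm_rpow_le`: Lemma 1.3 is the tree's `singularValues_compound_zero`, then § 1 and § 2 for the
  positive definite compounds), with equality of the full products (`k = n`, `prod_singularValues_wgm_rpow_eq`, from the
  determinants).
* § 4 **(2.3)**: `Π_{j<k} λ_j(Aᵖ #_t Bᵖ)^{1/p} ≤ Π_{j<k} λ_j(A^q #_t B^q)^{1/q}` for `0 < q ≤ p`
  (`prod_singularValues_wgm_rpow_mono`), and the consequences for unitarily invariant norms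
  «`‖Aʳ #_α Bʳ‖ ≤ ‖(A #_α B)ʳ‖`» (`seminorm_wgm_rpow_le`) and `Σ_{j<k} λ_j(Aʳ #_t Bʳ)^ρ ≤ Σ_{j<k} λ_j(A #_t B)^{rρ}`
  (`sum_singularValues_wgm_rpow_le`).

NOT covered: the singular case `A, B ≥ 0` (continuity in `ε ↓ 0`), Theorems 3.x (complementary Golden–Thompson),
the exponential form `{e^{pH} #_α e^{pK}}^{1/p}`.
-/

open Matrix Finset
open scoped ComplexOrder MatrixOrder Matrix.Norms.L2Operator

namespace Literature.LinearAlgebra.Matrix.AndoHiaiLogMajorization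

open Literature.LinearAlgebra.Matrix (compound compound_mul compound_inv posDef_compound posSemidef_compound)
open Literature.LinearAlgebra.Matrix.EigenvalueSingularValueMajorization (singularValues_compound_zero)
open Literature.LinearAlgebra.Matrix.ArakiLiebThirringLogMajorization (compound_rpow singularValues_zero_eq_norm
  det_rpow norm_det_eq_prod_eigenvalues)
open Literature.LinearAlgebra.Matrix.GoldenThompsonLogMajorization (sum_singularValues_rpow_le_of_prod_le
  seminorm_le_of_prod_singularValues_le)
open Literature.LinearAlgebra.Matrix.UnitarilyInvariantNormCauchySchwarzPowers (singularValues_rpow_of_posSemidef)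
open Literature.LinearAlgebra.Matrix.PosDefGeometricMean
open Literature.LinearAlgebra.Matrix.LoewnerHeinzInequality
open Literature.LinearAlgebra.Matrix.HadamardProductBlockInequalities
open Literature.LinearAlgebra.Matrix.WeightedGeometricMean
open Literature.LinearAlgebra.Matrix.AndoHiaiInequality

variable {n : Type*} [Fintype n] [LinearOrder n] {k : ℕ}

/-! ## § 1. Lemma 1.2: `C_k(A #_t B) = C_k(A) #_t C_k(B)`, and the determinant of a weighted geometric mean -/

section Compound

variable {A B : Matrix n n ℂ}

/-- `C_k(A^{1/2}) = C_k(A)^{1/2}` for `A ⪰ 0`. [cite: AndoHiai1994, § 1 p. 116 (proof of Lemma 1.2: `C_k` is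
multiplicative and commutes with powers)] -/
theorem compound_sqrt (hA : A.PosSemidef) : compound k (CFC.sqrt A) = CFC.sqrt (compound k A) := by
  rw [sqrt_eq_rpow, sqrt_eq_rpow, compound_rpow hA]

/-- **Lemma 1.2: `C_k(A #_t B) = C_k(A) #_t C_k(B)`** for `A ≻ 0`, `B ⪰ 0` and every real `t` (the compound is
multiplicative — Binet–Cauchy — and commutes with inverses, square roots and real powers of positive semidefinite
matrices). [cite: AndoHiai1994, Lemma 1.2, p. 116] -/
theorem compound_wgm (hA : A.PosDef) (hB : B.PosSemidef) (t : ℝ) :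
    compound k (CFC.sqrt A * ((CFC.sqrt A)⁻¹ * B * (CFC.sqrt A)⁻¹) ^ t * CFC.sqrt A) =
      CFC.sqrt (compound k A) * ((CFC.sqrt (compound k A))⁻¹ * compound k B * (CFC.sqrt (compound k A))⁻¹) ^ t *
        CFC.sqrt (compound k A) := by
  have hSu : IsUnit (CFC.sqrt A).det := isUnit_det_sqrt hA
  have hC : ((CFC.sqrt A)⁻¹ * B * (CFC.sqrt A)⁻¹).PosSemidef := by
    have h := hB.conjTranspose_mul_mul_same (CFC.sqrt A)⁻¹
    rwa [conjTranspose_nonsing_inv, conjTranspose_sqrt] at h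
  rw [compound_mul, compound_mul, compound_rpow hC, compound_mul, compound_mul, ← compound_inv _ hSu,
    compound_sqrt hA.posSemidef]

/-- «`C_k(Aʳ #_α Bʳ) = C_k(A)ʳ #_α C_k(B)ʳ`» for `A, B ≻ 0`. [cite: AndoHiai1994, proof of Thm 2.1, p. 119] -/
theorem compound_wgm_rpow (hA : A.PosDef) (hB : B.PosDef) (r t : ℝ) :
    compound k (CFC.sqrt (A ^ r) * ((CFC.sqrt (A ^ r))⁻¹ * B ^ r * (CFC.sqrt (A ^ r))⁻¹) ^ t * CFC.sqrt (A ^ r)) =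
      CFC.sqrt (compound k A ^ r) *
          ((CFC.sqrt (compound k A ^ r))⁻¹ * compound k B ^ r * (CFC.sqrt (compound k A ^ r))⁻¹) ^ t *
        CFC.sqrt (compound k A ^ r) := by
  rw [compound_wgm (posDef_rpow hA r) (posSemidef_rpow B r), compound_rpow hA.posSemidef, compound_rpow hB.posSemidef]

/-- `|det Xˢ| = |det X|ˢ` for `X ⪰ 0` and real `s`. [cite: AndoHiai1994, proof of Thm 2.1, p. 119
(«`det(Aʳ #_α Bʳ) = (det A)^{r(1−α)}(det B)^{rα}`»)] -/
theorem norm_det_rpow {X : Matrix n n ℂ} (hX : X.PosSemidef) (s : ℝ) : ‖(X ^ s).det‖ = ‖X.det‖ ^ s := by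
  rw [det_rpow hX s, Complex.norm_real, Real.norm_eq_abs,
    abs_of_nonneg (Real.rpow_nonneg (Finset.prod_nonneg fun i _ => hX.eigenvalues_nonneg i) _),
    norm_det_eq_prod_eigenvalues hX]

/-- **`|det(A #_t B)| = |det A|^{1−t} |det B|^t`** for `A, B ≻ 0` and every real `t`. [cite: AndoHiai1994, proof of
Thm 2.1, p. 119 («`(det A)^{r(1−α)}(det B)^{rα}`»)] -/
theorem norm_det_wgm (hA : A.PosDef) (hB : B.PosDef) (t : ℝ) :
    ‖(CFC.sqrt A * ((CFC.sqrt A)⁻¹ * B * (CFC.sqrt A)⁻¹) ^ t * CFC.sqrt A).det‖ = ‖A.det‖ ^ (1 - t) * ‖B.det‖ ^ t := by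
  have hC := posDef_sqrt_inv_mul_mul_sqrt_inv hA hB
  have hSS : CFC.sqrt A * CFC.sqrt A = A := CFC.sqrt_mul_sqrt_self A hA.posSemidef.nonneg
  have ha : 0 < ‖A.det‖ := norm_pos_iff.mpr hA.det_pos.ne'
  have hs : ‖(CFC.sqrt A).det‖ * ‖(CFC.sqrt A).det‖ = ‖A.det‖ := by rw [← norm_mul, ← det_mul, hSS]
  have hsi : ‖((CFC.sqrt A)⁻¹).det‖ * ‖((CFC.sqrt A)⁻¹).det‖ = ‖A.det‖⁻¹ := by
    rw [← norm_mul, ← det_mul, ← Matrix.mul_inv_rev, hSS, det_nonsing_inv, Ring.inverse_eq_inv', norm_inv]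
  have hCdet : ‖((CFC.sqrt A)⁻¹ * B * (CFC.sqrt A)⁻¹).det‖ = ‖B.det‖ * ‖A.det‖⁻¹ := by
    rw [det_mul, det_mul, norm_mul, norm_mul, mul_comm (‖((CFC.sqrt A)⁻¹).det‖) (‖B.det‖), mul_assoc, hsi]
  rw [det_mul, det_mul, norm_mul, norm_mul, norm_det_rpow hC.posSemidef, hCdet,
    mul_comm (‖(CFC.sqrt A).det‖) _, mul_assoc, hs, Real.mul_rpow (norm_nonneg _) (inv_nonneg.mpr ha.le),
    Real.inv_rpow ha.le, Real.rpow_sub ha, Real.rpow_one]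
  field_simp

/-- «`det(Aʳ #_α Bʳ) = det(A #_α B)ʳ`» in absolute value, `A, B ≻ 0`. [cite: AndoHiai1994, proof of Thm 2.1, p. 119] -/
theorem norm_det_wgm_rpow (hA : A.PosDef) (hB : B.PosDef) (r t : ℝ) :
    ‖(CFC.sqrt (A ^ r) * ((CFC.sqrt (A ^ r))⁻¹ * B ^ r * (CFC.sqrt (A ^ r))⁻¹) ^ t * CFC.sqrt (A ^ r)).det‖ =
      ‖(CFC.sqrt A * ((CFC.sqrt A)⁻¹ * B * (CFC.sqrt A)⁻¹) ^ t * CFC.sqrt A).det‖ ^ r := by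
  rw [norm_det_wgm (posDef_rpow hA r) (posDef_rpow hB r), norm_det_wgm hA hB, norm_det_rpow hA.posSemidef,
    norm_det_rpow hB.posSemidef, Real.mul_rpow (Real.rpow_nonneg (norm_nonneg _) _) (Real.rpow_nonneg (norm_nonneg _) _),
    ← Real.rpow_mul (norm_nonneg _), ← Real.rpow_mul (norm_nonneg _), ← Real.rpow_mul (norm_nonneg _),
    ← Real.rpow_mul (norm_nonneg _), mul_comm r (1 - t), mul_comm r t]

end Compound

/-! ## § 2. (2.5): `‖Aʳ #_t Bʳ‖ ≤ ‖A #_t B‖ʳ`, i.e. `λ₁(Aʳ #_t Bʳ) ≤ λ₁(A #_t B)ʳ` -/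

section NormForm

variable {m : Type*} [Fintype m] [DecidableEq m] {A B : Matrix m m ℂ}

/-- **(2.5), spectral-norm form: `‖Aʳ #_t Bʳ‖ ≤ ‖A #_t B‖ʳ`** for `A, B ≻ 0`, `t ∈ [0, 1]`, `r ≥ 1` (the tree's
`andoHiai_smul` with `c = ‖A #_t B‖`: `A #_t B ≤ ‖A #_t B‖·I`). [cite: AndoHiai1994, Thm 2.1 (2.5), p. 119] -/
theorem norm_wgm_rpow_le (hA : A.PosDef) (hB : B.PosDef) {t : ℝ} (ht0 : 0 ≤ t) (ht1 : t ≤ 1) {r : ℝ} (hr : 1 ≤ r) :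
    ‖CFC.sqrt (A ^ r) * ((CFC.sqrt (A ^ r))⁻¹ * B ^ r * (CFC.sqrt (A ^ r))⁻¹) ^ t * CFC.sqrt (A ^ r)‖ ≤
      ‖CFC.sqrt A * ((CFC.sqrt A)⁻¹ * B * (CFC.sqrt A)⁻¹) ^ t * CFC.sqrt A‖ ^ r := by
  letI : CStarAlgebra (Matrix m m ℂ) := {}
  have hG := posDef_wgm hA hB t
  have hGr := posDef_wgm (posDef_rpow hA r) (posDef_rpow hB r) t
  set c : ℝ := ‖CFC.sqrt A * ((CFC.sqrt A)⁻¹ * B * (CFC.sqrt A)⁻¹) ^ t * CFC.sqrt A‖ with hc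
  rcases isEmpty_or_nonempty m with hm | hm
  · have h0 : CFC.sqrt (A ^ r) * ((CFC.sqrt (A ^ r))⁻¹ * B ^ r * (CFC.sqrt (A ^ r))⁻¹) ^ t * CFC.sqrt (A ^ r) = 0 :=
      Subsingleton.elim _ _
    rw [h0, norm_zero]
    exact Real.rpow_nonneg (norm_nonneg _) _
  · have hc0 : 0 < c := norm_pos_iff.mpr fun h => (hG.det_pos.ne' (by rw [h, det_zero])).elim
    -- `A #_t B ≤ cI`
    have h1 : (c • (1 : Matrix m m ℂ) -
        CFC.sqrt A * ((CFC.sqrt A)⁻¹ * B * (CFC.sqrt A)⁻¹) ^ t * CFC.sqrt A).PosSemidef := by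
      have h := IsSelfAdjoint.le_algebraMap_norm_self hG.1.isSelfAdjoint
      rw [Algebra.algebraMap_eq_smul_one] at h
      exact Matrix.le_iff.mp h
    have h2 := andoHiai_smul hA hB ht0 ht1 hr hc0 h1
    have h3 : CFC.sqrt (A ^ r) * ((CFC.sqrt (A ^ r))⁻¹ * B ^ r * (CFC.sqrt (A ^ r))⁻¹) ^ t * CFC.sqrt (A ^ r) ≤
        algebraMap ℝ (Matrix m m ℂ) (c ^ r) := by
      rw [Algebra.algebraMap_eq_smul_one]
      exact Matrix.le_iff.mpr h2
    exact (CStarAlgebra.norm_le_iff_le_algebraMap _ (Real.rpow_nonneg hc0.le r) hGr.posSemidef.nonneg).mpr h3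

/-- **(2.5): `λ₁(Aʳ #_t Bʳ) ≤ λ₁(A #_t B)ʳ`** (largest singular value = largest eigenvalue of these positive definite
matrices). [cite: AndoHiai1994, Thm 2.1 (2.5), p. 119] -/
theorem singularValues_zero_wgm_rpow_le (hA : A.PosDef) (hB : B.PosDef) {t : ℝ} (ht0 : 0 ≤ t) (ht1 : t ≤ 1) {r : ℝ}
    (hr : 1 ≤ r) :
    (Matrix.toEuclideanLin
        (CFC.sqrt (A ^ r) * ((CFC.sqrt (A ^ r))⁻¹ * B ^ r * (CFC.sqrt (A ^ r))⁻¹) ^ t * CFC.sqrt (A ^ r))).singularValues 0 ≤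
      (Matrix.toEuclideanLin
        (CFC.sqrt A * ((CFC.sqrt A)⁻¹ * B * (CFC.sqrt A)⁻¹) ^ t * CFC.sqrt A)).singularValues 0 ^ r := by
  rw [singularValues_zero_eq_norm, singularValues_zero_eq_norm]
  exact norm_wgm_rpow_le hA hB ht0 ht1 hr

end NormForm

/-! ## § 3. Theorem 2.1 (2.2): `Π_{j<k} λ_j(Aʳ #_t Bʳ) ≤ Π_{j<k} λ_j(A #_t B)ʳ` -/

section LogMajorization

variable {A B : Matrix n n ℂ}

/-- **Theorem 2.1 (2.2), the Ando–Hiai log-majorization: `Π_{j<k} λ_j(Aʳ #_t Bʳ) ≤ Π_{j<k} λ_j(A #_t B)ʳ`** for every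
`k`, `A, B ≻ 0`, `t ∈ [0, 1]`, `r ≥ 1` (Lemma 1.3: the prefix product is `λ₁` of the `k`-th compound; Lemma 1.2: the
compound of a mean is the mean of the compounds; then (2.5) for the positive definite compounds).
[cite: AndoHiai1994, Thm 2.1 (2.2), pp. 118–119] -/
theorem prod_singularValues_wgm_rpow_le (hA : A.PosDef) (hB : B.PosDef) {t : ℝ} (ht0 : 0 ≤ t) (ht1 : t ≤ 1) {r : ℝ}
    (hr : 1 ≤ r) (k : ℕ) :
    ∏ j ∈ range k, (Matrix.toEuclideanLin
        (CFC.sqrt (A ^ r) * ((CFC.sqrt (A ^ r))⁻¹ * B ^ r * (CFC.sqrt (A ^ r))⁻¹) ^ t * CFC.sqrt (A ^ r))).singularValues j ≤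
      ∏ j ∈ range k, (Matrix.toEuclideanLin
        (CFC.sqrt A * ((CFC.sqrt A)⁻¹ * B * (CFC.sqrt A)⁻¹) ^ t * CFC.sqrt A)).singularValues j ^ r := by
  rw [Real.finsetProd_rpow _ _ (fun j _ => LinearMap.singularValues_nonneg _ _), ← singularValues_compound_zero _ k,
    ← singularValues_compound_zero _ k, compound_wgm_rpow hA hB, compound_wgm hA hB.posSemidef]
  exact singularValues_zero_wgm_rpow_le (posDef_compound hA) (posDef_compound hB) ht0 ht1 hr

/-- **The determinant clause of (2.2): equality of the full products**, `Π_{j<n} λ_j(Aʳ #_t Bʳ) = Π_{j<n} λ_j(A #_t B)ʳ`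
(`|det X| = Π_j σ_j(X)`). [cite: AndoHiai1994, Thm 2.1 (2.2) with § 1 p. 115 («`det A = det B`»), p. 119] -/
theorem prod_singularValues_wgm_rpow_eq (hA : A.PosDef) (hB : B.PosDef) (r t : ℝ) :
    ∏ j ∈ range (Fintype.card n), (Matrix.toEuclideanLin
        (CFC.sqrt (A ^ r) * ((CFC.sqrt (A ^ r))⁻¹ * B ^ r * (CFC.sqrt (A ^ r))⁻¹) ^ t * CFC.sqrt (A ^ r))).singularValues j =
      ∏ j ∈ range (Fintype.card n), (Matrix.toEuclideanLin
        (CFC.sqrt A * ((CFC.sqrt A)⁻¹ * B * (CFC.sqrt A)⁻¹) ^ t * CFC.sqrt A)).singularValues j ^ r := by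
  rw [Real.finsetProd_rpow _ _ (fun j _ => LinearMap.singularValues_nonneg _ _),
    ← Literature.LinearAlgebra.Matrix.SingularValueProductMajorization.norm_det_eq_prod_singularValues,
    ← Literature.LinearAlgebra.Matrix.SingularValueProductMajorization.norm_det_eq_prod_singularValues,
    norm_det_wgm_rpow hA hB]

end LogMajorization

/-! ## § 4. (2.3): the monotone family, unitarily invariant norms, power sums -/

section Consequences

variable {A B : Matrix n n ℂ}

/-- **Theorem 2.1 (2.3): `Π_{j<k} λ_j(Aᵖ #_t Bᵖ)^{1/p} ≤ Π_{j<k} λ_j(A^q #_t B^q)^{1/q}` for `0 < q ≤ p`** and every `k`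
((2.2) for `(A^q, B^q)` with `r = p/q`). [cite: AndoHiai1994, Thm 2.1 (2.3), p. 119] -/
theorem prod_singularValues_wgm_rpow_mono (hA : A.PosDef) (hB : B.PosDef) {t : ℝ} (ht0 : 0 ≤ t) (ht1 : t ≤ 1)
    {p q : ℝ} (hq : 0 < q) (hqp : q ≤ p) (k : ℕ) :
    ∏ j ∈ range k, (Matrix.toEuclideanLin
        (CFC.sqrt (A ^ p) * ((CFC.sqrt (A ^ p))⁻¹ * B ^ p * (CFC.sqrt (A ^ p))⁻¹) ^ t * CFC.sqrt (A ^ p))).singularValues j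
          ^ (1 / p) ≤
      ∏ j ∈ range k, (Matrix.toEuclideanLin
        (CFC.sqrt (A ^ q) * ((CFC.sqrt (A ^ q))⁻¹ * B ^ q * (CFC.sqrt (A ^ q))⁻¹) ^ t * CFC.sqrt (A ^ q))).singularValues j
          ^ (1 / q) := by
  have hp : 0 < p := hq.trans_le hqp
  have hr : 1 ≤ p / q := (one_le_div hq).mpr hqp
  have h := prod_singularValues_wgm_rpow_le (posDef_rpow hA q) (posDef_rpow hB q) ht0 ht1 hr k
  rw [rpow_rpow' hA, rpow_rpow' hB, show q * (p / q) = p by field_simp] at h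
  rw [Real.finsetProd_rpow _ _ (fun j _ => LinearMap.singularValues_nonneg _ _),
    Real.finsetProd_rpow _ _ (fun j _ => LinearMap.singularValues_nonneg _ _)]
  rw [Real.finsetProd_rpow _ _ (fun j _ => LinearMap.singularValues_nonneg _ _)] at h
  have hnn : 0 ≤ ∏ j ∈ range k, (Matrix.toEuclideanLin
      (CFC.sqrt (A ^ q) * ((CFC.sqrt (A ^ q))⁻¹ * B ^ q * (CFC.sqrt (A ^ q))⁻¹) ^ t * CFC.sqrt (A ^ q))).singularValues j :=
    Finset.prod_nonneg fun j _ => LinearMap.singularValues_nonneg _ _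
  have h2 := Real.rpow_le_rpow (Finset.prod_nonneg fun j _ => LinearMap.singularValues_nonneg _ _) h
    (one_div_pos.mpr hp).le
  rwa [← Real.rpow_mul hnn, show p / q * (1 / p) = 1 / q by field_simp] at h2

/-- **«`‖Aʳ #_α Bʳ‖ ≤ ‖(A #_α B)ʳ‖` for any unitarily invariant norm»** (`A, B ≻ 0`, `t ∈ [0, 1]`, `r ≥ 1`): log
majorization implies weak majorization, hence Ky Fan dominance (the tree's `seminorm_le_of_prod_singularValues_le`;
`σ_j((A #_t B)ʳ) = σ_j(A #_t B)ʳ`). [cite: AndoHiai1994, § 1 p. 115 («`‖A‖ ≤ ‖B‖` for any unitarily invariant norm»),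
Thm 2.1 (2.2) p. 119] -/
theorem seminorm_wgm_rpow_le (N : Seminorm ℂ (Matrix n n ℂ))
    (hui : ∀ U V : Matrix n n ℂ, U ∈ Matrix.unitaryGroup n ℂ → V ∈ Matrix.unitaryGroup n ℂ →
      ∀ X : Matrix n n ℂ, N (U * X * V) = N X)
    (hA : A.PosDef) (hB : B.PosDef) {t : ℝ} (ht0 : 0 ≤ t) (ht1 : t ≤ 1) {r : ℝ} (hr : 1 ≤ r) :
    N (CFC.sqrt (A ^ r) * ((CFC.sqrt (A ^ r))⁻¹ * B ^ r * (CFC.sqrt (A ^ r))⁻¹) ^ t * CFC.sqrt (A ^ r)) ≤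
      N ((CFC.sqrt A * ((CFC.sqrt A)⁻¹ * B * (CFC.sqrt A)⁻¹) ^ t * CFC.sqrt A) ^ r) := by
  refine seminorm_le_of_prod_singularValues_le N hui fun k => ?_
  have h := prod_singularValues_wgm_rpow_le hA hB ht0 ht1 hr k
  refine h.trans_eq (Finset.prod_congr rfl fun j _ => ?_)
  rw [singularValues_rpow_of_posSemidef (posDef_wgm hA hB t).posSemidef (by linarith) j]

/-- **Power sums: `Σ_{j<k} λ_j(Aʳ #_t Bʳ)^ρ ≤ Σ_{j<k} λ_j(A #_t B)^{rρ}`** for `ρ > 0` and every `k` (weak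
log-majorization ⟹ weak majorization of every positive power, Zhan Thm 2.7 in the tree).
[cite: AndoHiai1994, § 1 p. 115 («`A ≺_(log) B` implies `A ≺_w B`»), Thm 2.1 (2.2) p. 119] -/
theorem sum_singularValues_wgm_rpow_le (hA : A.PosDef) (hB : B.PosDef) {t : ℝ} (ht0 : 0 ≤ t) (ht1 : t ≤ 1) {r : ℝ}
    (hr : 1 ≤ r) {ρ : ℝ} (hρ : 0 < ρ) (k : ℕ) :
    ∑ j ∈ range k, (Matrix.toEuclideanLin
        (CFC.sqrt (A ^ r) * ((CFC.sqrt (A ^ r))⁻¹ * B ^ r * (CFC.sqrt (A ^ r))⁻¹) ^ t * CFC.sqrt (A ^ r))).singularValues j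
          ^ ρ ≤
      ∑ j ∈ range k, (Matrix.toEuclideanLin
        (CFC.sqrt A * ((CFC.sqrt A)⁻¹ * B * (CFC.sqrt A)⁻¹) ^ t * CFC.sqrt A)).singularValues j ^ (r * ρ) := by
  have hmaj : ∀ k, ∏ j ∈ range k, (Matrix.toEuclideanLin
      (CFC.sqrt (A ^ r) * ((CFC.sqrt (A ^ r))⁻¹ * B ^ r * (CFC.sqrt (A ^ r))⁻¹) ^ t * CFC.sqrt (A ^ r))).singularValues j ≤
      ∏ j ∈ range k, (Matrix.toEuclideanLin
        ((CFC.sqrt A * ((CFC.sqrt A)⁻¹ * B * (CFC.sqrt A)⁻¹) ^ t * CFC.sqrt A) ^ r)).singularValues j := by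
    intro k
    refine (prod_singularValues_wgm_rpow_le hA hB ht0 ht1 hr k).trans_eq (Finset.prod_congr rfl fun j _ => ?_)
    rw [singularValues_rpow_of_posSemidef (posDef_wgm hA hB t).posSemidef (by linarith) j]
  have h := sum_singularValues_rpow_le_of_prod_le hmaj hρ k
  refine h.trans_eq (Finset.sum_congr rfl fun j _ => ?_)
  rw [singularValues_rpow_of_posSemidef (posDef_wgm hA hB t).posSemidef (by linarith) j, ← Real.rpow_mul
    (LinearMap.singularValues_nonneg _ _)]

end Consequences

end Literature.LinearAlgebra.Matrix.AndoHiaiLogMajorization
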